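import Mathlib.LinearAlgebra.Matrix.PosDef
import Mathlib.LinearAlgebra.Matrix.NonsingularInverse
import Summits.RiemannHypothesis.RiemannHypothesis.Theorems.PfPersistenceF2PlantedIndex
import HarnessLib

/-!
# HANDOFF — the RANK-ONE PENCIL, exactly: `A − t·v vᵀ ⪰ 0 ↔ t·⟨v, A⁻¹v⟩ ≤ 1` for a positive definite real matrix (cell rh-explicit, TRACK «HANDOFF», seat theory-2 gen6; a PROVABLE-NOW T1 shard)

HONEST FRAMING. Nothing here bears on the truth of RH; this is finite-dimensional real linear algebra. The cell's wall-offset law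
(STRUCTURE C-I(b); conj-1 MARGIN-LAW §3B / T1.1 «(L1) PENCIL LEMMA»; weil-9 T17 §21.2) rests on the step «exact linear algebra
`λ_min(A − t·b⊗b) = 0 ⟺ t·⟨b, A⁻¹b⟩ = 1` for `A ≻ 0`», labelled there «paper-level, NOT formalised». At SECTION level `A` is the Gram
matrix of Weil's form on the trial space at the entrance bandwidth and `t·b⊗b` the first-order (rank-one, edge-amplitude) model of the
new prime's gain; the N = ∞ nonlinear statement «the wall is the unit level set of the capacity» is theory-2's `HandoffCapacity`
(XII-h). This file kernel-checks the algebraic step and its two companions: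
* `sq_dotProduct_le_resolvent` — Cauchy–Schwarz in the `A`-inner product against the resolvent vector:
  `(v·x)² ≤ ⟨v, A⁻¹v⟩·⟨x, Ax⟩` for every `x`, with EQUALITY at `x = A⁻¹v` (`sq_dotProduct_resolvent`): the rank-one capacity
  `sup_x (v·x)²/⟨x, Ax⟩` IS the resolvent value `⟨v, A⁻¹v⟩` (the finite-dimensional Birman–Schwinger principle for rank one).
* `posSemidef_sub_rankOne_iff` — for `A ≻ 0`, `t ≥ 0`: **`A − t·v vᵀ ⪰ 0 ↔ t·⟨v, A⁻¹v⟩ ≤ 1`**; hence the CROSSING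
  `not_posSemidef_sub_rankOne_iff : ¬(A − t·v vᵀ ⪰ 0) ↔ 1 < t·⟨v, A⁻¹v⟩` — as the coupling `t` grows the pencil loses positivity exactly
  at `t* = 1/⟨v, A⁻¹v⟩` (when `v ≠ 0`), the formula behind «δ*·w_q = 1/(2·Cap)» once the gain is linearised as `t = 2w_q·δ`.
What is NOT here (and stays MODEL/DERIVED in T1): the linearisation of the prime's gain in the overshoot `δ` and its error term, the
identification of `Cap` with near-null spectral data, any limit `N → ∞` (see `HandoffCapacityFoot` for why no linear law survives at the
foot). References: M. Sh. Birman, Mat. Sb. 55 (1961) / J. Schwinger, PNAS 47 (1961) (coupling-constant principle); J. Sherman,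
W. Morrison, Ann. Math. Stat. 21 (1950) 124–127 (rank-one updates); as read in R. Frank, A. Laptev, T. Weidl, *Schrödinger Operators:
Eigenvalues and Lieb–Thirring Inequalities* (CUP 2023) §1.2.8. All statements are folklore linear algebra.
-/

set_option linter.dupNamespace false  -- the mandated namespace repeats `RiemannHypothesis`

open Matrix

namespace Summit.RiemannHypothesis.RiemannHypothesis.Theorems.HandoffRankOnePencil

variable {n : Type*} [Fintype n] [DecidableEq n] {A : Matrix n n ℝ}

omit [Fintype n] [DecidableEq n] in
/-- A positive definite real matrix is symmetric: `A j i = A i j`. [folklore] -/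
theorem apply_comm (hA : A.PosDef) (i j : n) : A j i = A i j := by
  simpa using hA.1.apply i j

omit [Fintype n] [DecidableEq n] in
/-- … i.e. `Aᵀ = A`. [folklore] -/
theorem transpose_eq (hA : A.PosDef) : Aᵀ = A := by
  ext i j
  exact apply_comm hA i j

omit [DecidableEq n] in
/-- Symmetry of the `A`-form: `w·(Ax) = (Aw)·x`. [folklore] -/
theorem dotProduct_mulVec_comm (hA : A.PosDef) (w x : n → ℝ) : w ⬝ᵥ (A *ᵥ x) = (A *ᵥ w) ⬝ᵥ x := by
  rw [dotProduct_mulVec, ← mulVec_transpose, transpose_eq hA]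

/-- The resolvent vector `A⁻¹v` solves `A w = v`. [folklore] -/
theorem mulVec_inv_mulVec (hA : A.PosDef) (v : n → ℝ) : A *ᵥ (A⁻¹ *ᵥ v) = v := by
  rw [mulVec_mulVec, mul_nonsing_inv _ ((isUnit_iff_isUnit_det _).1 hA.isUnit), one_mulVec]

omit [DecidableEq n] in
/-- The `A`-form is non-negative. [folklore] -/
theorem dotProduct_mulVec_nonneg (hA : A.PosDef) (x : n → ℝ) : 0 ≤ x ⬝ᵥ (A *ᵥ x) := by
  simpa using (posSemidef_iff_dotProduct_mulVec.mp hA.posSemidef).2 x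

/-- The resolvent value `⟨v, A⁻¹v⟩ = ⟨w, Aw⟩` (`w = A⁻¹v`) is non-negative. [folklore] -/
theorem resolvent_nonneg (hA : A.PosDef) (v : n → ℝ) : 0 ≤ v ⬝ᵥ (A⁻¹ *ᵥ v) := by
  have h := dotProduct_mulVec_nonneg hA (A⁻¹ *ᵥ v)
  rwa [mulVec_inv_mulVec hA, dotProduct_comm] at h

/-- `⟨v, A⁻¹v⟩ = 0` forces `v = 0`. [folklore] -/
theorem eq_zero_of_resolvent_eq_zero (hA : A.PosDef) {v : n → ℝ} (h : v ⬝ᵥ (A⁻¹ *ᵥ v) = 0) : v = 0 := by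
  set w := A⁻¹ *ᵥ v with hw
  have hAw : A *ᵥ w = v := mulVec_inv_mulVec hA v
  by_contra hv
  have hw0 : w ≠ 0 := by
    intro h0
    apply hv
    rw [← hAw, h0, mulVec_zero]
  have hpos := hA.dotProduct_mulVec_pos hw0
  rw [star_trivial, hAw, dotProduct_comm] at hpos
  exact absurd h hpos.ne'

omit [DecidableEq n] in
/-- The quadratic form of the pencil: `x·((A − t·v vᵀ)x) = x·(Ax) − t·(v·x)²`. [folklore] -/
theorem dotProduct_pencil_mulVec (A : Matrix n n ℝ) (t : ℝ) (v x : n → ℝ) :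
    x ⬝ᵥ ((A - t • vecMulVec v v) *ᵥ x) = x ⬝ᵥ (A *ᵥ x) - t * (v ⬝ᵥ x) ^ 2 := by
  rw [sub_mulVec, smul_mulVec, PfPersistenceF2PlantedIndex.vecMulVec_mulVec_eq, dotProduct_sub, dotProduct_smul, dotProduct_smul,
    dotProduct_comm x v, smul_eq_mul, smul_eq_mul]
  ring

omit [Fintype n] [DecidableEq n] in
/-- The pencil is symmetric. [folklore] -/
theorem isHermitian_pencil (hA : A.PosDef) (t : ℝ) (v : n → ℝ) : (A - t • vecMulVec v v).IsHermitian := by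
  refine Matrix.IsHermitian.ext fun i j ↦ ?_
  rw [star_trivial, Matrix.sub_apply, Matrix.sub_apply, Matrix.smul_apply, Matrix.smul_apply, vecMulVec_apply, vecMulVec_apply,
    apply_comm hA i j, mul_comm (v j) (v i)]

/-- **Cauchy–Schwarz in the `A`-inner product against the resolvent vector**: `(v·x)² ≤ ⟨v, A⁻¹v⟩·⟨x, Ax⟩` for every `x`
(expand `0 ≤ ⟨x − λw, A(x − λw)⟩`, `w = A⁻¹v`, at the optimal `λ`). [folklore] -/
theorem sq_dotProduct_le_resolvent (hA : A.PosDef) (v x : n → ℝ) :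
    (v ⬝ᵥ x) ^ 2 ≤ (v ⬝ᵥ (A⁻¹ *ᵥ v)) * (x ⬝ᵥ (A *ᵥ x)) := by
  set w := A⁻¹ *ᵥ v with hw
  set c := v ⬝ᵥ w with hc
  have hAw : A *ᵥ w = v := mulVec_inv_mulVec hA v
  have hexp : ∀ l : ℝ, 0 ≤ x ⬝ᵥ (A *ᵥ x) - 2 * l * (v ⬝ᵥ x) + l ^ 2 * c := by
    intro l
    have h0 := dotProduct_mulVec_nonneg hA (x - l • w)
    have h1 : w ⬝ᵥ (A *ᵥ x) = v ⬝ᵥ x := by rw [dotProduct_mulVec_comm hA, hAw]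
    have e : (x - l • w) ⬝ᵥ (A *ᵥ (x - l • w)) = x ⬝ᵥ (A *ᵥ x) - 2 * l * (v ⬝ᵥ x) + l ^ 2 * c := by
      rw [mulVec_sub, mulVec_smul, hAw, sub_dotProduct, dotProduct_sub, dotProduct_sub, smul_dotProduct, smul_dotProduct,
        dotProduct_smul, dotProduct_smul, h1, dotProduct_comm x v, dotProduct_comm w v]
      simp only [smul_eq_mul]
      ring
    rwa [e] at h0
  have hc0 : 0 ≤ c := resolvent_nonneg hA v
  rcases hc0.lt_or_eq with hcpos | hczero
  · have h := hexp ((v ⬝ᵥ x) / c)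
    have e : x ⬝ᵥ (A *ᵥ x) - 2 * ((v ⬝ᵥ x) / c) * (v ⬝ᵥ x) + ((v ⬝ᵥ x) / c) ^ 2 * c =
        x ⬝ᵥ (A *ᵥ x) - (v ⬝ᵥ x) ^ 2 / c := by
      field_simp
      ring
    rw [e, sub_nonneg, div_le_iff₀ hcpos] at h
    linarith
  · have hv : v = 0 := eq_zero_of_resolvent_eq_zero hA hczero.symm
    rw [hv, zero_dotProduct, ← hczero]
    simp

/-- … with EQUALITY at the resolvent vector: `(v·A⁻¹v)² = ⟨v, A⁻¹v⟩·⟨A⁻¹v, A A⁻¹v⟩` — the rank-one capacity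
`sup_x (v·x)²/⟨x, Ax⟩` is ATTAINED and equals `⟨v, A⁻¹v⟩`. [folklore] -/
theorem sq_dotProduct_resolvent (hA : A.PosDef) (v : n → ℝ) :
    (v ⬝ᵥ (A⁻¹ *ᵥ v)) ^ 2 = (v ⬝ᵥ (A⁻¹ *ᵥ v)) * ((A⁻¹ *ᵥ v) ⬝ᵥ (A *ᵥ (A⁻¹ *ᵥ v))) := by
  rw [mulVec_inv_mulVec hA, dotProduct_comm (A⁻¹ *ᵥ v) v, sq]

/-- **THE RANK-ONE PENCIL.** For a positive definite real matrix `A`, a vector `v` and a coupling `t ≥ 0`: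
`A − t·v vᵀ` is positive semidefinite iff `t·⟨v, A⁻¹v⟩ ≤ 1`. (⇒: test on `x = A⁻¹v`; ⇐: Cauchy–Schwarz above.)
[folklore; cite: the coupling-constant / Birman–Schwinger principle for rank one, Sherman–Morrison] -/
theorem posSemidef_sub_rankOne_iff (hA : A.PosDef) (v : n → ℝ) {t : ℝ} (ht : 0 ≤ t) :
    (A - t • vecMulVec v v).PosSemidef ↔ t * (v ⬝ᵥ (A⁻¹ *ᵥ v)) ≤ 1 := by
  set c := v ⬝ᵥ (A⁻¹ *ᵥ v) with hc
  have hc0 : 0 ≤ c := resolvent_nonneg hA v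
  constructor
  · intro h
    have hw := (posSemidef_iff_dotProduct_mulVec.mp h).2 (A⁻¹ *ᵥ v)
    rw [star_trivial, dotProduct_pencil_mulVec, mulVec_inv_mulVec hA, dotProduct_comm (A⁻¹ *ᵥ v) v, ← hc] at hw
    -- `hw : 0 ≤ c − t·c²`
    rcases hc0.lt_or_eq with hcpos | hczero
    · nlinarith
    · rw [← hczero, mul_zero]; exact zero_le_one
  · intro htc
    refine PosSemidef.of_dotProduct_mulVec_nonneg (isHermitian_pencil hA t v) fun x ↦ ?_
    rw [star_trivial, dotProduct_pencil_mulVec]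
    have hcs := sq_dotProduct_le_resolvent hA v x
    have hx := dotProduct_mulVec_nonneg hA x
    rw [← hc] at hcs
    nlinarith [mul_le_mul_of_nonneg_left hcs ht, mul_nonneg (sub_nonneg.2 htc) hx]

/-- **The crossing.** For `A ≻ 0`, `t ≥ 0`: positivity of the pencil FAILS iff `1 < t·⟨v, A⁻¹v⟩`; for `v ≠ 0` the critical coupling is
`t* = 1/⟨v, A⁻¹v⟩` exactly (the «δ*·w = 1/(2·Cap)» shape of the cell's wall-offset law, at the level of linear algebra). [folklore] -/
theorem not_posSemidef_sub_rankOne_iff (hA : A.PosDef) (v : n → ℝ) {t : ℝ} (ht : 0 ≤ t) :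
    ¬ (A - t • vecMulVec v v).PosSemidef ↔ 1 < t * (v ⬝ᵥ (A⁻¹ *ᵥ v)) := by
  rw [posSemidef_sub_rankOne_iff hA v ht, not_le]

/-- The critical coupling in closed form: for `v ≠ 0` (so `⟨v, A⁻¹v⟩ > 0`) and `t ≥ 0`,
`A − t·v vᵀ ⪰ 0 ↔ t ≤ 1/⟨v, A⁻¹v⟩`. [folklore] -/
theorem posSemidef_sub_rankOne_iff_le_inv (hA : A.PosDef) {v : n → ℝ} (hv : v ≠ 0) {t : ℝ} (ht : 0 ≤ t) :
    (A - t • vecMulVec v v).PosSemidef ↔ t ≤ 1 / (v ⬝ᵥ (A⁻¹ *ᵥ v)) := by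
  have hcpos : 0 < v ⬝ᵥ (A⁻¹ *ᵥ v) :=
    (resolvent_nonneg hA v).lt_of_ne fun h ↦ hv (eq_zero_of_resolvent_eq_zero hA h.symm)
  rw [posSemidef_sub_rankOne_iff hA v ht, le_div_iff₀ hcpos]

end Summit.RiemannHypothesis.RiemannHypothesis.Theorems.HandoffRankOnePencil
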